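import Literature.NumberTheory.LFunctions.ZetaFourthMomentWeak
import Literature.NumberTheory.LFunctions.ApproxFunctionalEquation
import HarnessLib

/-!
# Discharge of the weak fourth power moment of `ζ` on the critical line

Topic `Literature/NumberTheory/LFunctions`. This file closes the named fact
`Literature.NumberTheory.LFunctions.zetaFourthMomentWeak`
(`Literature/NumberTheory/LFunctions/ZetaFourthMomentWeak.lean`):

  `∀ ε > 0, ∃ C, ∀ T ≥ 1, ∫_0^T |ζ(1/2+it)|⁴ dt ≤ C T^{1+ε}`,

the `T^ε`-weakening of Hardy–Littlewood's `∫_1^T |ζ(1/2+it)|⁴ dt = O(T log⁴ T)` (Titchmarsh,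
*The Theory of the Riemann Zeta-Function*, 2nd ed., §7.6 eq. (7.6.1)), UNCONDITIONALLY, by composing
the two halves of Titchmarsh's argument that are already proved in the tree:

* `Literature.NumberTheory.LFunctions.zetaFourthMomentWeak_of_eq43` (`ZetaFourthMomentWeak.lean`) —
  Titchmarsh's proof of Thm 7.5 "followed out with `σ = 1/2`" (§7.6): the fourth moment from the
  consequence `|ζ(1/2+it)| ≤ 2|∑_{n ≤ √(t/2π)} n^{-1/2+it}| + C` of the approximate functional
  equation on the critical line (the named fact `Literature.NumberTheory.LFunctions.Bourgain2017_eq43`,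
  Titchmarsh (4.17.1) / Bourgain 2017 (4.3));
* `Literature.NumberTheory.LFunctions.Bourgain2017_eq43_holds` (`ApproxFunctionalEquation.lean`) — the
  discharge of that named fact from the Hardy–Littlewood approximate functional equation
  (Titchmarsh, Theorem 4.13 on the critical line).

The discharge lives in this sibling file (not in `ZetaFourthMomentWeak.lean` itself) only to keep the
import graph of `ZetaFourthMomentWeak.lean` small: `ApproxFunctionalEquation.lean` imports all of
Mathlib. Nothing else is here.

## Main statement

* `Literature.NumberTheory.LFunctions.zetaFourthMomentWeak_holds : zetaFourthMomentWeak`.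

## References

* E. C. Titchmarsh, *The Theory of the Riemann Zeta-Function*, 2nd ed. (rev. D. R. Heath-Brown),
  Oxford 1986, §7.6 eq. (7.6.1); §7.5 (proof of Thm 7.5); §4.13 (Thm 4.13), §4.17 (4.17.1).
* G. H. Hardy, J. E. Littlewood, *The approximate functional equation in the theory of the zeta
  function*, Proc. LMS (2) 21 (1922), 39–74 (the original `O(T log⁴ T)`).
-/

noncomputable section

namespace Literature.NumberTheory.LFunctions

/-- **The weak fourth power moment of `ζ` on the critical line** (discharge of the named fact
`Literature.NumberTheory.LFunctions.zetaFourthMomentWeak`): for every `ε > 0` there is `C` with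
`∫_0^T |ζ(1/2+it)|⁴ dt ≤ C T^{1+ε}` for all `T ≥ 1` — the `T^ε`-weakening of Hardy–Littlewood's
`∫_1^T |ζ(1/2+it)|⁴ dt = O(T log⁴ T)`. Proof: Titchmarsh's proof of Thm 7.5 at `σ = 1/2`
(`zetaFourthMomentWeak_of_eq43`) applied to the approximate functional equation on the critical
line in the form `|ζ(1/2+it)| ≤ 2|∑_{n ≤ √(t/2π)} n^{-1/2+it}| + O(1)` (`Bourgain2017_eq43_holds`,
from Titchmarsh's Theorem 4.13). [cite: Titchmarsh1986, §7.6 eq. (7.6.1)] -/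
theorem zetaFourthMomentWeak_holds : zetaFourthMomentWeak :=
  zetaFourthMomentWeak_of_eq43 Bourgain2017_eq43_holds

end Literature.NumberTheory.LFunctions
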